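import Mathlib

/-!
# Solo-informed (s28): the socle lift and the forced end types of the integral two-strand model

Paper `EtaleDirection.md`, (16.13)(k)(3′)(a)–(b).  For the graded module `M = Cl(L)[7^∞]` over
`R = ℤ₇[X]/(X⁷+7X)` with norm image `V = j(C)` killed by `X`, the snake lemma for multiplication by
`X` on `0 → V → M → M/V → 0` reads: an element of the socle of `M/V`, represented by `m` with
`X • m ∈ V`, comes from the `X`-torsion of `M` iff `δ(m) := X • m` vanishes — so `M[X]/V ≅ ker δ`
and, with Chevalley's `|M[X]| = |C|`, the number of capitulating `ℤ/7`'s equals the number of free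
strand ends.  The second theorem is the degree bookkeeping that makes the end type of each strand
FORCED: a glued end must sit one step before a degree of `j(C)` (degrees `3, 5`), a free end needs a
non-norm unit of character `ω^(t+n)` and units of `K = F(ζ₇)` exist only for `ω⁰, ω¹, ω², ω⁴`;
the two residue sets are complementary.
-/

namespace Summit.Langlands.Langlands.Theorems

/-- (16.13)(k)(3′)(a), the connecting map.  If `X` kills the submodule `V`, then `m : M` is congruent
modulo `V` to an `X`-torsion element iff `X • m = 0`; in particular the socle elements of `M/V` that
lift to `M[X]` are exactly those with `δ(m) = X • m = 0`, i.e. `M[X]/V ≅ ker δ`. -/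
theorem soloInformed_socle_lift {R M : Type*} [CommRing R] [AddCommGroup M] [Module R M]
    (X : R) (V : Submodule R M) (hV : ∀ v ∈ V, X • v = 0) (m : M) :
    (∃ m' : M, X • m' = 0 ∧ m - m' ∈ V) ↔ X • m = 0 := by
  constructor
  · rintro ⟨m', hm', hmem⟩
    have h := hV _ hmem
    rwa [smul_sub, hm', sub_zero] at h
  · intro h
    exact ⟨m, h, by simp⟩

/-- (16.13)(k)(3′)(b), END TYPES ARE FORCED.  A strand generated in degree `t ∈ {3, 5}` of length
`n` ends in degree `t + n - 1 (mod 6)`.  Gluing into `j(C) = V₃ ⊕ V₅` needs `t + n ≡ 3, 5 (mod 6)`;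
a free end needs a non-norm unit of character `ω^(t+n)`, available only for `t + n ≡ 0, 1, 2, 4`.
Exactly one of the two holds, for every length. -/
theorem soloInformed_end_type_forced :
    ∀ t ∈ ({3, 5} : Finset ℕ), ∀ n ∈ Finset.Icc 1 24,
      ((t + n) % 6 ∈ ({3, 5} : Finset ℕ) ↔ (t + n) % 6 ∉ ({0, 1, 2, 4} : Finset ℕ)) := by
  decide

/-- The same bookkeeping read as the gluing SPECTRUM (law R1): for lengths `n ≤ 5` (the observed
range, where `ℓ_t = n_t`), the 3-strand is glued iff `n = 2` (into degree 5) and the 5-strand iff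
`n = 4` (into degree 3); every other length is free-ended. -/
theorem soloInformed_gluing_spectrum :
    (∀ n ∈ Finset.Icc 1 5, ((3 + n) % 6 ∈ ({3, 5} : Finset ℕ) ↔ n = 2)) ∧
    (∀ n ∈ Finset.Icc 1 5, ((5 + n) % 6 ∈ ({3, 5} : Finset ℕ) ↔ n = 4)) ∧
    (3 + 2) % 6 = 5 ∧ (5 + 4) % 6 = 3 := by
  decide

end Summit.Langlands.Langlands.Theorems
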